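import Summits.AtomisticToContinuum.FouriersLaw.Theorems.BondHeatUncertaintySubdiffusiveBondHeatOfFloorTransient
import Summits.AtomisticToContinuum.FouriersLaw.Theorems.BondHeatUncertaintySubdiffusiveBondHeatEscapeDeficitNonneg
import Summits.AtomisticToContinuum.FouriersLaw.Theorems.BondHeatUncertaintyTransferToBoundedResponse
import Summits.AtomisticToContinuum.FouriersLaw.Theorems.BondHeatUncertaintyLinearResponseFTUR
import Summits.AtomisticToContinuum.FouriersLaw.Theorems.JunctionLocalitySuperadditiveResistanceStubLinearResponsePlain
import Summits.AtomisticToContinuum.FouriersLaw.Theorems.EmbeddedDrudeMourreNessUnique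
import Literature.MathematicalPhysics.KineticTheory.LangevinChainNESSHolds

/-!
# `SubdiffusiveBondHeat` ⟺ `BoundedResponse` modulo `(K)` and the Ohm-free transient — the circularity witness, in tree

Helper file for crux stmt-AtomisticToContinuum-9120 (`BondHeatUncertainty.SubdiffusiveBondHeat`, (S)), line
`bath-bond-deficit-integral` (lead c5).  It LANDS, as importable theorems over tree vocabulary, the kernel-checked
structural result of crux-strategist s2 (`Cruxes/SubdiffusiveBondHeat/StrategistCircularityWitness.lean`,
`STRATEGY-CENSUS.md` §Decomposition), so that audits and priority computations can see it:

* `ohmicFloor_of_boundedResponse` / `boundedResponse_of_ohmicFloor`: the Ohm-carrying half of the line's one open stub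
  (`OhmicFloor`: `E_N ≤ C₁/N`, hypothesis 1 of the landed glue `subdiffusiveBondHeat_of_ohmicFloor_transientEW`, p138777)
  is EQUIVALENT to the route's own output `BondHeatUncertainty.BoundedResponse` (stmt-AtomisticToContinuum-11071) —
  by the response identity `D_N = (N−1)γE_N` (proved in tree: `…ThermaliseThenCutProbeInsertion.responseIdentity_proof`),
  weak-NESS uniqueness (`Theorems.nessUnique_proof`), existence of steady states (`pinnedChain_exists_isSteadyState`) and
  `0 ≤ E_N` (`escapeDeficit_nonneg`, p139693);
* `boundedResponse_of_extensiveSnapshotIrreversibility_subdiffusiveBondHeat`: `(K) → (S) → BoundedResponse` with the proved engine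
  `LinearResponseFTUR_proof` (9122) and the proved transfer `transferToBoundedResponse_proof` (9655);
* `subdiffusiveBondHeat_of_boundedResponse_transientEW`: `BoundedResponse → TransientEW → (S)` (p138777 with the floor
  discharged from the route's output);
* `subdiffusiveBondHeat_iff_boundedResponse`: `(K) → TransientEW → ((S) ↔ BoundedResponse)`.

Reading: modulo the route's other crux `(K)` and the Ohm-free Edwards–Wilkinson transient of the bath heat (`TransientEW`,
hypothesis 2 of p138777: `∫₀ᵗ(1 − θ_N(s) − E_N) ds ≤ C₂√t` on `[1, cN²]`), the crux (S) IS the route's output; every typed split of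
(S) therefore has a child equivalent to what `closes` produces.  The two hypotheses are written INLINE (no definitions).
No `sorry`; standard axioms.  Nothing here closes an item.
-/

noncomputable section

open MeasureTheory Filter Topology Set
open Literature.MathematicalPhysics.KineticTheory.HeatConduction

namespace Summit.AtomisticToContinuum.FouriersLaw.Theorems.SubdiffusiveBondHeat

open Summit.AtomisticToContinuum.FouriersLaw.Theses.BondHeatUncertainty
  (SubdiffusiveBondHeat ExtensiveSnapshotIrreversibility LinearResponseFTUR NessUnique BoundedResponse)
open Summit.AtomisticToContinuum.FouriersLaw.Theses.BoundaryEscapeDeficit (ResponseIdentity)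

/-! ## Abstract real arithmetic -/

/-- `|D_N| ≤ S` and `D_N = (N−1)γE_N` (`N ≥ 1`) give the floor `E_N ≤ (2S/γ)/N` for `N ≥ 2`. [folklore] -/
theorem escapeFloor_of_abs_response_le {E D : ℕ → ℝ} {γ S : ℝ} (hγ : 0 < γ)
    (hD : ∀ N : ℕ, 0 < N → D N = ((N : ℝ) - 1) * γ * E N) (hS : ∀ N : ℕ, |D N| ≤ S) :
    ∃ C₁ : ℝ, ∃ N₀ : ℕ, ∀ N : ℕ, N₀ ≤ N → E N ≤ C₁ / (N : ℝ) := by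
  refine ⟨2 * S / γ, 2, fun N hN => ?_⟩
  have hNr : (2 : ℝ) ≤ N := by exact_mod_cast hN
  have hNpos : (0 : ℝ) < N := by linarith
  have hpos : 0 < ((N : ℝ) - 1) * γ := mul_pos (by linarith) hγ
  have hS0 : 0 ≤ S := (abs_nonneg _).trans (hS N)
  have hle : ((N : ℝ) - 1) * γ * E N ≤ S := by
    rw [← hD N (by omega)]; exact (le_abs_self _).trans (hS N)
  have h1 : E N ≤ S / (((N : ℝ) - 1) * γ) := by
    rw [le_div_iff₀ hpos]
    calc E N * (((N : ℝ) - 1) * γ) = ((N : ℝ) - 1) * γ * E N := by ring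
      _ ≤ S := hle
  have h2 : S / (((N : ℝ) - 1) * γ) ≤ 2 * S / γ / (N : ℝ) := by
    rw [div_le_div_iff₀ hpos hNpos]
    have : (N : ℝ) ≤ 2 * ((N : ℝ) - 1) := by linarith
    calc S * (N : ℝ) ≤ S * (2 * ((N : ℝ) - 1)) := mul_le_mul_of_nonneg_left this hS0
      _ = 2 * S / γ * (((N : ℝ) - 1) * γ) := by field_simp
  exact h1.trans h2

/-- Conversely, `D_N = (N−1)γE_N` (`N ≥ 1`), `0 ≤ E_N` (`N ≥ 2`) and the floor `E_N ≤ C₁/N` (`N ≥ N₀`) give a bounded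
`|D_N|` (eventually `≤ γ·max C₁ 0`, finitely many `N` before). [folklore] -/
theorem bddAbove_abs_response_of_escapeFloor {E D : ℕ → ℝ} {γ C₁ : ℝ} {N₀ : ℕ} (hγ : 0 < γ)
    (hD : ∀ N : ℕ, 0 < N → D N = ((N : ℝ) - 1) * γ * E N) (hE0 : ∀ N : ℕ, 2 ≤ N → 0 ≤ E N)
    (hfl : ∀ N : ℕ, N₀ ≤ N → E N ≤ C₁ / (N : ℝ)) :
    BddAbove (Set.range fun N : ℕ => |D N|) := by
  have hev : ∀ N : ℕ, max N₀ 2 ≤ N → |D N| ≤ γ * max C₁ 0 := by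
    intro N hN
    have hN2 : 2 ≤ N := le_trans (le_max_right _ _) hN
    have hN0 : N₀ ≤ N := le_trans (le_max_left _ _) hN
    have hNr : (2 : ℝ) ≤ N := by exact_mod_cast hN2
    have hNpos : (0 : ℝ) < N := by linarith
    have hN1 : 0 ≤ (N : ℝ) - 1 := by linarith
    have hEN := hE0 N hN2
    have hDN : D N = ((N : ℝ) - 1) * γ * E N := hD N (by omega)
    have hDnn : 0 ≤ D N := by rw [hDN]; positivity
    rw [abs_of_nonneg hDnn, hDN]
    have hE1 : E N ≤ max C₁ 0 / (N : ℝ) :=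
      (hfl N hN0).trans (div_le_div_of_nonneg_right (le_max_left _ _) hNpos.le)
    have hE2 : ((N : ℝ) - 1) * E N ≤ max C₁ 0 := by
      have h := mul_le_mul_of_nonneg_left hE1 hN1
      have h' : ((N : ℝ) - 1) * (max C₁ 0 / (N : ℝ)) ≤ max C₁ 0 := by
        rw [mul_div_assoc']
        rw [div_le_iff₀ hNpos]
        nlinarith [le_max_right C₁ 0]
      exact h.trans h'
    calc ((N : ℝ) - 1) * γ * E N = γ * (((N : ℝ) - 1) * E N) := by ring
      _ ≤ γ * max C₁ 0 := mul_le_mul_of_nonneg_left hE2 hγ.le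
  have hbu : IsBoundedUnder (· ≤ ·) atTop (fun N : ℕ => |D N|) :=
    ⟨γ * max C₁ 0, eventually_atTop.2 ⟨max N₀ 2, hev⟩⟩
  rw [← Nat.cofinite_eq_atTop] at hbu
  exact hbu.bddAbove_range_of_cofinite

/-! ## The in-tree facts, by name -/

/-- Weak-NESS uniqueness (item 0741) as the `BondHeatUncertainty.NessUnique` decl — proved in tree (`Theorems.nessUnique_proof`;
the `NessUnique` decls of all routes are syntactically identical). -/
theorem bondHeatUncertainty_nessUnique_holds : NessUnique :=
  Summit.AtomisticToContinuum.FouriersLaw.Theorems.nessUnique_proof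

/-- The response identity `D_N = (N−1)γE_N` (item 12237, `BoundaryEscapeDeficit.ResponseIdentity`) — proved in tree as
`…ThermaliseThenCutProbeInsertion.responseIdentity_proof` (boundary Kubo identity of route `PhononMeanFreePath` transported by
`boundaryKubo_iff_responseIdentity`). -/
theorem boundaryEscapeDeficit_responseIdentity_holds : ResponseIdentity :=
  Summit.AtomisticToContinuum.FouriersLaw.Cruxes.SuperadditiveResistance.ThermaliseThenCutProbeInsertion.responseIdentity_proof

/-! ## The Ohmic floor at the contact is the route's output -/

/-- **`BoundedResponse ⟹ OhmicFloor`.**  Along the canonical steady-state family (existence theorem + choice), the proved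
response identity supplies response coefficients `D_N = (N−1)γE_N` (`N ≥ 1`; `D_0 = 0` by `totalCurrent_zero`); bounded
`|D_N|` is then the Ohmic floor `E_N ≤ (2 sup|D|/γ)/N`.  The conclusion is VERBATIM hypothesis 1 of
`subdiffusiveBondHeat_of_ohmicFloor_transientEW` (p138777). [folklore] -/
theorem ohmicFloor_of_boundedResponse : BoundedResponse →
    (∀ ω₂ lam β γ : ℝ, 0 < ω₂ → 0 < lam → 0 < β → 0 < γ → ∀ T : ℝ, 0 < T →
      ∃ C₁ : ℝ, ∃ N₀ : ℕ, ∀ N : ℕ, N₀ ≤ N →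
        1 - γ / T ^ 2 * (∫ u in Set.Ioi (0 : ℝ),
          if h : 0 < N then
            ∫ z, ((z.2 ⟨0, h⟩) ^ 2 - T) *
                (∫ y, ((y.2 ⟨0, h⟩) ^ 2 - T) ∂((pinnedChain ω₂ lam β γ).transitionKernel N T T u.toNNReal z))
              ∂((pinnedChain ω₂ lam β γ).gibbsMeasure N T)
          else 0) ≤ C₁ / (N : ℝ)) := by
  intro hB ω₂ lam β γ hω hl hβ hγ T hT
  classical
  have huniq := bondHeatUncertainty_nessUnique_holds ω₂ lam β γ hω hl hβ hγ
  -- the canonical steady-state family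
  let μ₀ : (N : ℕ) → ℝ → ℝ → MeasureTheory.Measure (PhaseSpace N) := fun N T_L T_R =>
    if h : 0 < T_L ∧ 0 < T_R then
      Classical.choose (pinnedChain_exists_isSteadyState hω hl hβ hγ N h.1 h.2) else 0
  have hμ₀ : ∀ (N : ℕ) (T_L T_R : ℝ), 0 < T_L → 0 < T_R →
      (pinnedChain ω₂ lam β γ).IsSteadyState N T_L T_R (μ₀ N T_L T_R) := by
    intro N T_L T_R hL' hR'
    simp only [μ₀, dif_pos (And.intro hL' hR')]
    exact Classical.choose_spec (pinnedChain_exists_isSteadyState hω hl hβ hγ N hL' hR')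
  have hRI := boundaryEscapeDeficit_responseIdentity_holds ω₂ lam β γ hω hl hβ hγ huniq μ₀ hμ₀ T hT
  dsimp only at hRI
  -- the escape expression
  let E : ℕ → ℝ := fun N => 1 - γ / T ^ 2 * (∫ u in Set.Ioi (0 : ℝ),
        if h : 0 < N then
          ∫ z, ((z.2 ⟨0, h⟩) ^ 2 - T) *
              (∫ y, ((y.2 ⟨0, h⟩) ^ 2 - T) ∂((pinnedChain ω₂ lam β γ).transitionKernel N T T u.toNNReal z))
            ∂((pinnedChain ω₂ lam β γ).gibbsMeasure N T)
        else 0)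
  let D : ℕ → ℝ := fun N => if N = 0 then 0 else ((N : ℝ) - 1) * γ * E N
  have hDpos : ∀ N : ℕ, 0 < N → D N = ((N : ℝ) - 1) * γ * E N := fun N hN => by
    simp [D, hN.ne']
  have hD : ∀ N : ℕ, Tendsto
      (fun δ : ℝ => (pinnedChain ω₂ lam β γ).totalCurrent (μ₀ N (T + δ / 2) (T - δ / 2)) / δ)
      (𝓝[≠] 0) (𝓝 (D N)) := by
    intro N
    rcases Nat.eq_zero_or_pos N with rfl | hN
    · have hD0 : D 0 = 0 := by simp [D]
      rw [hD0]
      simp only [OscillatorChain.totalCurrent_zero, zero_div]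
      exact tendsto_const_nhds
    · rw [hDpos N hN]
      exact (hRI N hN).2
  obtain ⟨S, hS⟩ := hB ω₂ lam β γ hω hl hβ hγ μ₀ hμ₀ T hT D hD
  have hS' : ∀ N : ℕ, |D N| ≤ S := fun N => hS ⟨N, rfl⟩
  exact escapeFloor_of_abs_response_le hγ hDpos hS'

/-- **`OhmicFloor ⟹ BoundedResponse`.**  Along ANY steady-state family with response coefficients `D`, uniqueness of limits in
`𝓝[≠] 0` and the proved response identity give `D_N = (N−1)γE_N` (`N ≥ 1`); `0 ≤ E_N` (`escapeDeficit_nonneg`, `N ≥ 2`) and the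
floor bound `|D_N|` eventually by `γ·max C₁ 0`. [folklore] -/
theorem boundedResponse_of_ohmicFloor :
    (∀ ω₂ lam β γ : ℝ, 0 < ω₂ → 0 < lam → 0 < β → 0 < γ → ∀ T : ℝ, 0 < T →
      ∃ C₁ : ℝ, ∃ N₀ : ℕ, ∀ N : ℕ, N₀ ≤ N →
        1 - γ / T ^ 2 * (∫ u in Set.Ioi (0 : ℝ),
          if h : 0 < N then
            ∫ z, ((z.2 ⟨0, h⟩) ^ 2 - T) *
                (∫ y, ((y.2 ⟨0, h⟩) ^ 2 - T) ∂((pinnedChain ω₂ lam β γ).transitionKernel N T T u.toNNReal z))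
              ∂((pinnedChain ω₂ lam β γ).gibbsMeasure N T)
          else 0) ≤ C₁ / (N : ℝ)) →
    BoundedResponse := by
  intro hO ω₂ lam β γ hω hl hβ hγ μ hμ T hT D hD
  have huniq := bondHeatUncertainty_nessUnique_holds ω₂ lam β γ hω hl hβ hγ
  have hRI := boundaryEscapeDeficit_responseIdentity_holds ω₂ lam β γ hω hl hβ hγ huniq μ hμ T hT
  dsimp only at hRI
  obtain ⟨C₁, N₀, hfl⟩ := hO ω₂ lam β γ hω hl hβ hγ T hT
  have hE0 := escapeDeficit_nonneg ω₂ lam β γ hω hl hβ hγ T hT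
  have hDpos : ∀ N : ℕ, 0 < N → D N = ((N : ℝ) - 1) * γ * (1 - γ / T ^ 2 * (∫ u in Set.Ioi (0 : ℝ),
        if h : 0 < N then
          ∫ z, ((z.2 ⟨0, h⟩) ^ 2 - T) *
              (∫ y, ((y.2 ⟨0, h⟩) ^ 2 - T) ∂((pinnedChain ω₂ lam β γ).transitionKernel N T T u.toNNReal z))
            ∂((pinnedChain ω₂ lam β γ).gibbsMeasure N T)
        else 0)) := fun N hN =>
    tendsto_nhds_unique (hD N) (hRI N hN).2
  exact bddAbove_abs_response_of_escapeFloor (N₀ := N₀) hγ hDpos hE0 hfl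

/-- **The Ohmic floor at the contact ⟺ the route's output `BoundedResponse` (stmt-AtomisticToContinuum-11071).** [folklore] -/
theorem boundedResponse_iff_ohmicFloor : BoundedResponse ↔
    (∀ ω₂ lam β γ : ℝ, 0 < ω₂ → 0 < lam → 0 < β → 0 < γ → ∀ T : ℝ, 0 < T →
      ∃ C₁ : ℝ, ∃ N₀ : ℕ, ∀ N : ℕ, N₀ ≤ N →
        1 - γ / T ^ 2 * (∫ u in Set.Ioi (0 : ℝ),
          if h : 0 < N then
            ∫ z, ((z.2 ⟨0, h⟩) ^ 2 - T) *
                (∫ y, ((y.2 ⟨0, h⟩) ^ 2 - T) ∂((pinnedChain ω₂ lam β γ).transitionKernel N T T u.toNNReal z))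
              ∂((pinnedChain ω₂ lam β γ).gibbsMeasure N T)
          else 0) ≤ C₁ / (N : ℝ)) :=
  ⟨ohmicFloor_of_boundedResponse, boundedResponse_of_ohmicFloor⟩

/-! ## The cycle -/

/-- Forward (the route, all in tree): `(K) ∧ (S) ⟹ BoundedResponse` — `transferToBoundedResponse_proof` (9655) fed with the proved
engine `LinearResponseFTUR_proof` (9122) and the proved `NessUnique` (0741). -/
theorem boundedResponse_of_extensiveSnapshotIrreversibility_subdiffusiveBondHeat :
    ExtensiveSnapshotIrreversibility → SubdiffusiveBondHeat → BoundedResponse := fun hK hS =>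
  Summit.AtomisticToContinuum.FouriersLaw.Theorems.transferToBoundedResponse_proof hS hK
    Summit.AtomisticToContinuum.FouriersLaw.Theorems.LinearResponseFTUR_proof bondHeatUncertainty_nessUnique_holds

/-- Backward: **`BoundedResponse ∧ TransientEW ⟹ (S)`** — the landed glue `subdiffusiveBondHeat_of_ohmicFloor_transientEW` (p138777)
with the Ohmic floor discharged from the route's output.  The second hypothesis (`TransientEW`, the Ohm-free Edwards–Wilkinson
transient of the bath heat: `∫₀ᵗ(1 − θ_N(s) − E_N) ds ≤ C₂√t` on `[1, cN²]`) is VERBATIM hypothesis 2 of p138777; it has no item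
and no supplier (open-problem calibre; false for the harmonic member).  So a proof of `BoundedResponse` (11071) by ANY route reduces
crux 9120 to `TransientEW` alone. -/
theorem subdiffusiveBondHeat_of_boundedResponse_transientEW :
    Summit.AtomisticToContinuum.FouriersLaw.Theses.BondHeatUncertainty.BoundedResponse → (∀ ω₂ lam β γ : ℝ, 0 < ω₂ → 0 < lam → 0 < β → 0 < γ → ∀ T : ℝ, 0 < T → ∃ C₂ c : ℝ, 0 < c ∧ ∃ N₀ : ℕ, ∀ N : ℕ, N₀ ≤ N → ∀ t : ℝ, 1 ≤ t → t ≤ c * (N : ℝ) ^ 2 → (∫ s in (0 : ℝ)..t, (1 - γ / T ^ 2 * (∫ u in (0 : ℝ)..s, if h : 0 < N then ∫ z, ((z.2 ⟨0, h⟩) ^ 2 - T) * (∫ y, ((y.2 ⟨0, h⟩) ^ 2 - T) ∂((Literature.MathematicalPhysics.KineticTheory.HeatConduction.pinnedChain ω₂ lam β γ).transitionKernel N T T u.toNNReal z)) ∂((Literature.MathematicalPhysics.KineticTheory.HeatConduction.pinnedChain ω₂ lam β γ).gibbsMeasure N T) else 0) - (1 - γ / T ^ 2 * (∫ u in Set.Ioi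 (0 : ℝ), if h : 0 < N then ∫ z, ((z.2 ⟨0, h⟩) ^ 2 - T) * (∫ y, ((y.2 ⟨0, h⟩) ^ 2 - T) ∂((Literature.MathematicalPhysics.KineticTheory.HeatConduction.pinnedChain ω₂ lam β γ).transitionKernel N T T u.toNNReal z)) ∂((Literature.MathematicalPhysics.KineticTheory.HeatConduction.pinnedChain ω₂ lam β γ).gibbsMeasure N T) else 0)))) ≤ C₂ * Real.sqrt t) → Summit.AtomisticToContinuum.FouriersLaw.Theses.BondHeatUncertainty.SubdiffusiveBondHeat := fun hB hT =>
  subdiffusiveBondHeat_of_ohmicFloor_transientEW (ohmicFloor_of_boundedResponse hB) hT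

/-- **THE CIRCULARITY WITNESS.**  Modulo the route's other crux `(K)` (`ExtensiveSnapshotIrreversibility`, 9121) and the Ohm-free
transient `TransientEW` (hypothesis 2 of p138777, inline), the crux `(S)` of route `BondHeatUncertainty` is EQUIVALENT to the
route's output `BoundedResponse` (11071) — so the split `(S) ⟸ OhmicFloor ∧ TransientEW` would make `closes` consume its own
conclusion, and 9120 ranks with 11071 ∧ (EW factor).  Everything in tree except the two displayed hypotheses. -/
theorem subdiffusiveBondHeat_iff_boundedResponse : ExtensiveSnapshotIrreversibility →
    (∀ ω₂ lam β γ : ℝ, 0 < ω₂ → 0 < lam → 0 < β → 0 < γ → ∀ T : ℝ, 0 < T →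
      ∃ C₂ c : ℝ, 0 < c ∧ ∃ N₀ : ℕ, ∀ N : ℕ, N₀ ≤ N → ∀ t : ℝ, 1 ≤ t → t ≤ c * (N : ℝ) ^ 2 →
        (∫ s in (0 : ℝ)..t,
          (1 - γ / T ^ 2 * (∫ u in (0 : ℝ)..s,
              if h : 0 < N then
                ∫ z, ((z.2 ⟨0, h⟩) ^ 2 - T) *
                    (∫ y, ((y.2 ⟨0, h⟩) ^ 2 - T)
                      ∂((pinnedChain ω₂ lam β γ).transitionKernel N T T u.toNNReal z))
                  ∂((pinnedChain ω₂ lam β γ).gibbsMeasure N T)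
              else 0) -
            (1 - γ / T ^ 2 * (∫ u in Set.Ioi (0 : ℝ),
              if h : 0 < N then
                ∫ z, ((z.2 ⟨0, h⟩) ^ 2 - T) *
                    (∫ y, ((y.2 ⟨0, h⟩) ^ 2 - T)
                      ∂((pinnedChain ω₂ lam β γ).transitionKernel N T T u.toNNReal z))
                  ∂((pinnedChain ω₂ lam β γ).gibbsMeasure N T)
              else 0)))) ≤ C₂ * Real.sqrt t) →
    (SubdiffusiveBondHeat ↔ BoundedResponse) := fun hK hT =>
  ⟨boundedResponse_of_extensiveSnapshotIrreversibility_subdiffusiveBondHeat hK,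
    fun hB => subdiffusiveBondHeat_of_boundedResponse_transientEW hB hT⟩

end Summit.AtomisticToContinuum.FouriersLaw.Theorems.SubdiffusiveBondHeat

end
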